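import Literature.NumberTheory.Automorphic.SchneiderStuhlerTreeComplexAction   -- ★ 41d FILE II (F0P3-p02 (g26)): `rep_zeroChains_apply`, the `hτ`∕`hτ₁`∕`hρ₀`∕`hρ₁` letters; brings ★ FILE I (`C₀(S)`, `C₁(S)`, `finite_edges_of_finite`) and ★ row 23 (`mem_fixedPoints_map_conj_iff`)
import Literature.NumberTheory.Automorphic.SmoothCharacterCosetTrace          -- ★ TRACE-COSET (F0P3a-p03 (g28)): `levelTrace_eq_trace_restrict_of_mem_normalizer`; brings ★ `SmoothCharacter` (`Representation.levelTrace`)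
import Literature.LinearAlgebra.TracePermutedBlocks                            -- ★ row 37 (F0P3-p02 (g26)): `LinearMap.trace_eq_sum_trace_restrict_fixed_of_mapsTo`
import HarnessLib

/-!
# The trace of the stabiliser on the finite Schneider–Stuhler tree complex is the sum over the FIXED simplices of the level traces
# (Schneider–Stuhler 1997 III.4; Meyer–Solleveld 2010 §1 p. 4, §4 Prop. 4.1; Korman 2004 §4, §9)

Topic `NumberTheory/Automorphic`; namespaces `LinearMap` (§0, the generic engine over `Finsupp` blocks, a dot-style extension next to ★ row 37) and `Representation` (§1–§3).
THEOREMS ONLY (no definition, no instance, no notation, no named fact, no `sorry`).  E1 BRICK LEDGER row 41f-(A10) «TREE COMPLEX TRACE» (census «(SS-K) VIA THE RESOLUTION» v1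
§3 (A10), F0P3a-p04 (g31); split to this seat 2026-09-03T02:02Z; keeper F0P3a-p03 (g29)); consumer: ★∕⊙ 41f FILE B `SchneiderStuhlerCharacterElliptic` (F0P3a-p04), whose HEAD
`levelTrace_eq_fixedVertexSum_sub_fixedEdgeSum` subtracts (T2′) from (T1′) after ★ 41e's averaging.  HONEST LABEL: count-neutral generic base layer; HC_CM is proved only modulo
the 2 remaining named inputs (hLiu418 24832, h413 24833) until rung 0 closes.

THE MATHEMATICS.  Let `Σ` be a finite vertex set `S` of the graph `G` (the ball `B(o, R)` of ★ 41b at the datum), `C₀(S) = ⊕_{x ∈ S} V^{U_x}·[x] ⊆ ι →₀ V` and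
`C₁(S) = ⊕_{e ⊆ S} V^{U_e}·[e] ⊆ E(G) →₀ V` the chain modules of ★ 41d FILE I (`U_e = U_{head e} ⊔ U_{tail e}`), acted on by the stabiliser `P` of `S` through ★ 41d FILE II's
`ρ₀`, `ρ₁` (`(g·v)(x) = ρ(g) v(g⁻¹x)`).  An element `g ∈ P` PERMUTES the blocks: `g·(V^{U_x}·[x]) = V^{U_{gx}}·[gx]` (transport `U_{gx} = g U_x g⁻¹`, ★ row 23).  By ★ row 37
(the trace of a block-permuting endomorphism is the sum of the traces on the fixed blocks) `tr(g | C₀(S)) = Σ_{x ∈ S, gx = x} tr(ρ(g) | V^{U_x})`, and for a fixed `x` the element `g`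
normalises `U_x`, so `tr(ρ(g) | V^{U_x})` is the LEVEL TRACE `Θ_{U_x}(g)` of ★ `SmoothCharacter` (★ TRACE-COSET `levelTrace_eq_trace_restrict_of_mem_normalizer`) — a quantity defined for
every `g`, so that the sum is a plain `Finset.sum` over `{x ∈ S | gx = x}`.  Likewise on `C₁(S)` with the fixed EDGES (`g·e = e ⟺ g` fixes both ends, the orientation being invariant).

* §0 (ns `LinearMap`) `iSupIndep_map_lsingle` (the blocks `B_x·[x]` are independent, any family `B`), **`trace_eq_sum_of_finsupp_blocks`** — the engine: an endomorphism `f` of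
  `p = ⊕_{x ∈ s} B_x·[x]` agreeing with an ambient `F` that maps `B_x·[x]` to `B_{πx}·[πx]` by `single x v ↦ single (π x) (φ v)` (`π` injective on `s`, `s`-stable) has
  `tr f = Σ_{x ∈ s, πx = x} t x` for any `t` with `t x = tr(φ | B_x)` at the fixed `x` (★ row 37 inside `↥p`, Mathlib `isInternal_biSup_submodule_of_iSupIndep`, blocks transported along
  `lsingle x : B_x ≃ B_x·[x]` by `trace_conj'`).
* §1 transport one-liners: `mapsTo_fixedPoints_of_apply_eq` (T0), **`mem_normalizer_of_apply_eq`**, `mapEdgeSet_eq_self_iff_apply_eq` (A2), **`mem_normalizer_sup_of_mapEdgeSet_eq`**,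
  `single_mem_zeroChains`-free bookkeeping `apply_mem_fixedPoints_sup_of_mapEdgeSet`.
* §2 **`trace_rep_zeroChains_eq_sum`** (T1′): `tr(ρ₀ g | C₀(S)) = Σ_{x ∈ S, a g x = x} ρ.levelTrace (U x) g`.
* §3 **`trace_rep_oneChains_eq_sum`** (T2′): `tr(ρ₁ g | C₁(S)) = Σ_{e ⊆ S, (a g)·e = e} ρ.levelTrace (U_{head e} ⊔ U_{tail e}) g`.

## References
* [SchneiderStuhler1997] P. Schneider, U. Stuhler, *Representation theory and sheaves on the Bruhat–Tits building*, Publ. Math. IHÉS 85 (1997), Ch. III §4 (the trace of `g` on the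
  chain modules of a `g`-stable finite subcomplex; only fixed facets contribute).
* [MeyerSolleveld2010] R. Meyer, M. Solleveld, *Resolutions for representations of reductive p-adic groups via their buildings*, J. reine angew. Math. 647 (2010), §1 p. 4
  (`χ_Σ(g) = Σ_{σ ∈ Σ, gσ = σ} (−1)^{deg σ} χ_{V_σ}(g)`), §4 Prop. 4.1.
* [Korman2004] J. Korman, *A character formula for compact elements (the rank one case)*, arXiv:math/0409292, §4 (`Σ_q (−1)^q tr(T_γ; C_q)`), §9 Claim 39.
* [GetzHahn2024] J. Getz, H. Hahn, *An Introduction to Automorphic Representations* (2024), §8.5 (8.15) p. 159 (the level trace `Θ_K`).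
* [Bourbaki1989LieGroups13] N. Bourbaki, *Lie Groups and Lie Algebras, Chapters 1–3*: Ch. I §4 no. 3 Prop. 4 (d) (trace in a basis adapted to a stable decomposition).
-/

set_option autoImplicit false

open Set Function Module SimpleGraph
open scoped BigOperators
open Literature.NumberTheory.Automorphic Literature.Combinatorics.SimpleGraph Literature.Combinatorics.SimpleGraph.OrientedIncidence

/-! ## §0 The engine: the trace of an endomorphism permuting the `lsingle` blocks of a finite sum -/

namespace LinearMap

variable {k : Type*} [Field k] {V : Type*} [AddCommGroup V] [Module k V] {α : Type*}

/-- **The blocks `B_x·[x] = (lsingle x)(B_x)` of `α →₀ V` are independent** (any family `B`; generalises ★ 41d FILE I `iSupIndep_zeroBlocks`∕`iSupIndep_oneBlocks`, same proof over Mathlib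
`Finsupp.disjoint_lsingle_lsingle`). [cite: SchneiderStuhler1997, Ch. II §3 p. 123] -/
theorem iSupIndep_map_lsingle (B : α → Submodule k V) : iSupIndep fun x : α => (B x).map (Finsupp.lsingle x : V →ₗ[k] α →₀ V) := by
  classical
  intro x
  have hle : ∀ y : α, (B y).map (Finsupp.lsingle y : V →ₗ[k] α →₀ V) ≤ LinearMap.range (Finsupp.lsingle y : V →ₗ[k] α →₀ V) :=
    fun y => LinearMap.map_le_range
  have h := Finsupp.disjoint_lsingle_lsingle (M := V) (R := k) ({x} : Set α) {y | y ≠ x} (by simp)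
  refine h.mono ?_ ?_
  · exact (hle x).trans (le_biSup (fun a => LinearMap.range (Finsupp.lsingle a : V →ₗ[k] α →₀ V)) (Set.mem_singleton x))
  · exact iSup_le fun y => iSup_le fun hy => (hle y).trans (le_biSup (fun a => LinearMap.range (Finsupp.lsingle a : V →ₗ[k] α →₀ V)) hy)

/-- **Trace on a nested block through a model.**  For `Q ≤ p ≤ M₀` and a linear model `e : W ≃ Q`, an endomorphism `X` of the nested block `Q.comap p.subtype ≤ ↥p` that acts
as `Y ∈ End(W)` through `e` has `tr X = tr Y` (`trace_conj'` along `e ≫ (comapSubtypeEquivOfLe)⁻¹`; stated generically so that the block instances unify syntactically downstream).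
[cite: Bourbaki1989LieGroups13, Ch. I §4 no. 3 Prop. 4 (d)] -/
theorem trace_comap_subtype_eq_of_model {M₀ : Type*} [AddCommGroup M₀] [Module k M₀] {p Q : Submodule k M₀} (hle : Q ≤ p)
    {W : Type*} [AddCommGroup W] [Module k W] (e : W ≃ₗ[k] Q) (X : Module.End k (Q.comap p.subtype)) (Y : Module.End k W)
    (h : ∀ w : W, (((X ((Submodule.comapSubtypeEquivOfLe hle).symm (e w)) : Q.comap p.subtype) : p) : M₀) = ((e (Y w) : Q) : M₀)) :
    LinearMap.trace k (Q.comap p.subtype) X = LinearMap.trace k W Y := by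
  let E : W ≃ₗ[k] (Q.comap p.subtype) := e.trans (Submodule.comapSubtypeEquivOfLe hle).symm
  have hconj : X = E.conj Y := by
    apply LinearMap.ext
    intro z
    obtain ⟨w, rfl⟩ := E.surjective z
    rw [LinearEquiv.conj_apply_apply, LinearEquiv.symm_apply_apply]
    apply Subtype.ext
    apply Subtype.ext
    exact h w
  rw [hconj, LinearMap.trace_conj']

/-- **THE ENGINE (A10).**  Let `p = ⊕_{x ∈ s} B_x·[x] ⊆ α →₀ V` (`s` finite, the `B_x`, `x ∈ s`, finite-dimensional), `f ∈ End(p)` agreeing on `p` with an ambient linear `F` that acts on the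
blocks by `F (single x v) = single (π x) (φ v)` (`x ∈ s`, `v ∈ B_x`) for a map `π` injective on `s` with `π(s) ⊆ s` and a linear `φ : V → V` with `φ(B_x) ⊆ B_{πx}`.  Then
`tr f = Σ_{x ∈ s, πx = x} t x` for ANY `t : α → k` with `t x = tr(φ | B_x)` at the fixed `x ∈ s` (the user's currency; e.g. a level trace).  Proof: ★ row 37 inside `↥p` on the
internal direct sum `x ↦ (B_x·[x]).comap p.subtype` (Mathlib `isInternal_biSup_submodule_of_iSupIndep`), the fixed blocks transported to `B_x` along `lsingle x` (`trace_conj'`).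
[cite: MeyerSolleveld2010, §1 p. 4] [cite: SchneiderStuhler1997, Ch. III §4] [cite: Korman2004, §4] -/
theorem trace_eq_sum_of_finsupp_blocks [DecidableEq α] {B : α → Submodule k V} {s : Finset α} (hfd : ∀ x ∈ s, FiniteDimensional k (B x))
    {p : Submodule k (α →₀ V)} (hp : p = ⨆ x ∈ s, (B x).map (Finsupp.lsingle x : V →ₗ[k] α →₀ V))
    {π : α → α} (hπs : ∀ x ∈ s, π x ∈ s) (hπ : Set.InjOn π s)
    {φ : V →ₗ[k] V} (hφ : ∀ x ∈ s, ∀ v ∈ B x, φ v ∈ B (π x)) (hfix : ∀ x ∈ s, π x = x → ∀ v ∈ B x, φ v ∈ B x)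
    {F : (α →₀ V) →ₗ[k] (α →₀ V)} (hF : ∀ x ∈ s, ∀ v ∈ B x, F (Finsupp.single x v) = Finsupp.single (π x) (φ v))
    {f : Module.End k p} (hf : ∀ w : p, ((f w : p) : α →₀ V) = F (w : α →₀ V))
    {t : α → k} (ht : ∀ (x : α) (hx : x ∈ s) (hπx : π x = x), t x = LinearMap.trace k (B x) (φ.restrict (hfix x hx hπx))) :
    LinearMap.trace k p f = ∑ x ∈ s with π x = x, t x := by
  classical
  set N : α → Submodule k (α →₀ V) := fun x => (B x).map (Finsupp.lsingle x : V →ₗ[k] α →₀ V) with hN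
  have hle : ∀ x ∈ s, N x ≤ p := fun x hx => by rw [hp]; exact le_biSup N hx
  -- the blocks are independent and form an internal direct sum of `p`
  have hind : iSupIndep fun i : s => N i := (iSupIndep_map_lsingle B).comp Subtype.val_injective
  have hint : DirectSum.IsInternal fun i : s => (N i).comap p.subtype :=
    hp ▸ DirectSum.isInternal_biSup_submodule_of_iSupIndep (s : Set α) hind
  -- `p` is finite-dimensional
  haveI : ∀ i : s, FiniteDimensional k (N i) := fun i => by
    haveI := hfd i i.2
    exact Module.Finite.map _ _
  haveI : FiniteDimensional k p := by
    have hp' : p = ⨆ i : s, N (i : α) := by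
      rw [hp]
      apply le_antisymm
      · exact iSup_le fun x => iSup_le fun hx => le_iSup (fun i : s => N (i : α)) ⟨x, hx⟩
      · exact iSup_le fun i => le_biSup N i.2
    rw [hp']
    infer_instance
  -- the permutation of `s`
  let σ' : s → s := fun i => ⟨π i, hπs i i.2⟩
  have hσ' : Function.Injective σ' := fun i j h => Subtype.ext (hπ i.2 j.2 (congrArg Subtype.val h))
  -- membership in a block
  have hmem : ∀ (i : s) (w : p), w ∈ (N i).comap p.subtype ↔ ∃ v ∈ B (i : α), (w : α →₀ V) = Finsupp.single (i : α) v := fun i w => by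
    simp only [Submodule.mem_comap, Submodule.subtype_apply, hN, Submodule.mem_map, Finsupp.lsingle_apply]
    exact ⟨fun ⟨v, hv, h⟩ => ⟨v, hv, h.symm⟩, fun ⟨v, hv, h⟩ => ⟨v, hv, h.symm⟩⟩
  -- `f` permutes the blocks along `σ'`
  have hf' : ∀ i : s, MapsTo f ((N i).comap p.subtype) ((N (σ' i)).comap p.subtype) := by
    intro i w hw
    obtain ⟨v, hv, hw⟩ := (hmem i w).1 hw
    refine (hmem (σ' i) (f w)).2 ⟨φ v, hφ i i.2 v hv, ?_⟩
    rw [hf w, hw, hF i i.2 v hv]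
  have hfix' : ∀ i : s, σ' i = i → MapsTo f ((N i).comap p.subtype) ((N i).comap p.subtype) := by
    intro i hi
    have h := hf' i
    rwa [hi] at h
  -- ★ row 37
  rw [LinearMap.trace_eq_sum_trace_restrict_fixed_of_mapsTo hint hσ' hf' hfix']
  -- the fixed blocks, one by one
  have hblock : ∀ (i : s) (hi : σ' i = i), LinearMap.trace k ((N i).comap p.subtype) (f.restrict (hfix' i hi)) = t i := by
    intro i hi
    have hπi : π i = i := congrArg Subtype.val hi
    haveI := hfd i i.2
    rw [ht i i.2 hπi]
    let e' : B (i : α) ≃ₗ[k] N i := Submodule.equivMapOfInjective (Finsupp.lsingle (i : α) : V →ₗ[k] α →₀ V) (Finsupp.single_injective (i : α)) (B i)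
    have he' : ∀ v : B (i : α), ((e' v : N i) : α →₀ V) = Finsupp.single (i : α) (v : V) := fun v => by
      show ((Submodule.equivMapOfInjective (Finsupp.lsingle (i : α) : V →ₗ[k] α →₀ V) (Finsupp.single_injective (i : α)) (B i) v : N i) : α →₀ V) = _
      rw [Submodule.coe_equivMapOfInjective_apply, Finsupp.lsingle_apply]
    refine trace_comap_subtype_eq_of_model (hle i i.2) e' _ _ fun w => ?_
    have hEw : ((((Submodule.comapSubtypeEquivOfLe (hle i i.2)).symm (e' w) : (N i).comap p.subtype) : p) : α →₀ V) = Finsupp.single (i : α) (w : V) := he' w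
    rw [LinearMap.coe_restrict_apply, hf, hEw, hF i i.2 w w.2, hπi, he', LinearMap.coe_restrict_apply]
  calc ∑ i : {i : s // σ' i = i}, LinearMap.trace k ((N i).comap p.subtype) (f.restrict (hfix' i i.2))
      = ∑ i : {i : s // σ' i = i}, t i := Fintype.sum_congr _ _ fun i => hblock i i.2
    _ = ∑ i ∈ (Finset.univ : Finset s).filter (fun i => σ' i = i), t i := (Finset.sum_subtype _ (fun i => by simp) (fun i : s => t i)).symm
    _ = ∑ i : s, if π i = i then t i else 0 := by
        rw [Finset.sum_filter]
        exact Finset.sum_congr rfl fun i _ => by simp only [σ', Subtype.ext_iff]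
    _ = ∑ x ∈ s, if π x = x then t x else 0 := Finset.sum_coe_sort s (fun x => if π x = x then t x else 0)
    _ = ∑ x ∈ s with π x = x, t x := (Finset.sum_filter _ _).symm

end LinearMap

/-! ## §1 Transport one-liners: a stabilised vertex ∕ edge has its level group normalised -/

namespace Representation

variable {k Γ V : Type*} [Field k] [CharZero k] [Group Γ] [TopologicalSpace Γ] [IsTopologicalGroup Γ]
  [AddCommGroup V] [Module k V] {ρ : Representation k Γ V}
variable {ι : Type*} [DecidableEq ι] {G : SimpleGraph ι} {a : Γ →* (G ≃g G)}

omit [CharZero k] [TopologicalSpace Γ] [IsTopologicalGroup Γ] [DecidableEq ι] in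
/-- (T0) **A stabilised vertex has an invariant block**: `U_{g·x} = g U_x g⁻¹` and `g·x = x` give `ρ(g) V^{U_x} ⊆ V^{U_x}` (★ row 23 transport). [cite: SchneiderStuhler1997, Ch. III §4]
[cite: Korman2004, §9 Claim 39] -/
theorem mapsTo_fixedPoints_of_apply_eq {U : ι → Subgroup Γ} (hUa : ∀ (g : Γ) (x : ι), U (a g x) = (U x).map (MulAut.conj g).toMonoidHom)
    {g : Γ} {x : ι} (hx : a g x = x) : MapsTo (ρ g) (ρ.fixedPoints (U x)) (ρ.fixedPoints (U x)) := by
  intro v hv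
  have h := (ρ.mem_fixedPoints_map_conj_iff (U x) g v).2 hv
  rw [← hUa, hx] at h
  exact h

omit [CharZero k] [TopologicalSpace Γ] [IsTopologicalGroup Γ] [DecidableEq ι] in
/-- **A stabilised vertex has its level group NORMALISED**: `g·x = x ⇒ g ∈ N_Γ(U_x)` (so `Θ_{U_x}(g) = tr(ρ(g) | V^{U_x})`, ★ TRACE-COSET). [cite: Korman2004, §9 Claim 39]
[cite: SchneiderStuhler1997, Ch. III §4] -/
theorem mem_normalizer_of_apply_eq {U : ι → Subgroup Γ} (hUa : ∀ (g : Γ) (x : ι), U (a g x) = (U x).map (MulAut.conj g).toMonoidHom)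
    {g : Γ} {x : ι} (hx : a g x = x) : g ∈ Subgroup.normalizer (U x : Set Γ) := by
  rw [Subgroup.mem_normalizer_iff_map_conj_eq, ← MulEquiv.toMonoidHom_eq_coe, ← hUa, hx]

omit [CharZero k] [TopologicalSpace Γ] [IsTopologicalGroup Γ] [DecidableEq ι] in
/-- (A2) **With an INVARIANT orientation an automorphism fixes an edge iff it fixes both ends** (no inversion; `←` is ★ 41a `mapEdgeSet_eq_self_of_forall_apply_eq` in `Iso` dress).
[cite: SchneiderStuhler1997, Ch. III §4] [cite: MeyerSolleveld2010, §1 p. 4] -/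
theorem mapEdgeSet_eq_self_iff_apply_eq {σ : Orientation G}
    (hσa : ∀ (g : Γ) (e : G.edgeSet), σ.head ((a g).mapEdgeSet e) = a g (σ.head e) ∧ σ.tail ((a g).mapEdgeSet e) = a g (σ.tail e))
    (g : Γ) (e : G.edgeSet) : (a g).mapEdgeSet e = e ↔ a g (σ.head e) = σ.head e ∧ a g (σ.tail e) = σ.tail e := by
  constructor
  · intro he
    have h := hσa g e
    rw [he] at h
    exact ⟨h.1.symm, h.2.symm⟩
  · rintro ⟨hh, ht⟩
    apply Subtype.ext
    rw [Iso.mapEdgeSet_apply, Hom.mapEdgeSet_coe, ← σ.mk_head_tail e, Sym2.map_mk]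
    show s(a g (σ.head e), a g (σ.tail e)) = _
    rw [hh, ht]

omit [CharZero k] [TopologicalSpace Γ] [IsTopologicalGroup Γ] [DecidableEq ι] in
/-- **A stabilised edge has its level group NORMALISED**: `g·e = e ⇒ g ∈ N_Γ(U_{head e} ⊔ U_{tail e})` (invariant orientation, transported vertex groups). [cite: Korman2004, §9 Claim 39]
[cite: SchneiderStuhler1997, Ch. III §4] -/
theorem mem_normalizer_sup_of_mapEdgeSet_eq {U : ι → Subgroup Γ} (hUa : ∀ (g : Γ) (x : ι), U (a g x) = (U x).map (MulAut.conj g).toMonoidHom) {σ : Orientation G}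
    (hσa : ∀ (g : Γ) (e : G.edgeSet), σ.head ((a g).mapEdgeSet e) = a g (σ.head e) ∧ σ.tail ((a g).mapEdgeSet e) = a g (σ.tail e))
    {g : Γ} {e : G.edgeSet} (he : (a g).mapEdgeSet e = e) : g ∈ Subgroup.normalizer ((U (σ.head e) ⊔ U (σ.tail e) : Subgroup Γ) : Set Γ) := by
  obtain ⟨hh, ht⟩ := (mapEdgeSet_eq_self_iff_apply_eq hσa g e).1 he
  rw [Subgroup.mem_normalizer_iff_map_conj_eq, Subgroup.map_sup, ← MulEquiv.toMonoidHom_eq_coe, ← hUa, ← hUa, hh, ht]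

omit [CharZero k] [TopologicalSpace Γ] [IsTopologicalGroup Γ] [DecidableEq ι] in
/-- **The edge blocks are permuted**: `ρ(g) V^{U_e} ⊆ V^{U_{g·e}}` with `U_e = U_{head e} ⊔ U_{tail e}` (transport + invariant orientation). [cite: SchneiderStuhler1997, Ch. III §4]
[cite: MeyerSolleveld2010, §4 Prop. 4.1] -/
theorem apply_mem_fixedPoints_sup_of_mapEdgeSet {U : ι → Subgroup Γ} (hUa : ∀ (g : Γ) (x : ι), U (a g x) = (U x).map (MulAut.conj g).toMonoidHom) {σ : Orientation G}
    (hσa : ∀ (g : Γ) (e : G.edgeSet), σ.head ((a g).mapEdgeSet e) = a g (σ.head e) ∧ σ.tail ((a g).mapEdgeSet e) = a g (σ.tail e))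
    (g : Γ) (e : G.edgeSet) {v : V} (hv : v ∈ ρ.fixedPoints (U (σ.head e) ⊔ U (σ.tail e))) :
    ρ g v ∈ ρ.fixedPoints (U (σ.head ((a g).mapEdgeSet e)) ⊔ U (σ.tail ((a g).mapEdgeSet e))) := by
  have h := (ρ.mem_fixedPoints_map_conj_iff (U (σ.head e) ⊔ U (σ.tail e)) g v).2 hv
  rw [Subgroup.map_sup, ← hUa, ← hUa, ← (hσa g e).1, ← (hσa g e).2] at h
  exact h

/-! ## §2 (T1′) The trace on the `0`-chains `C₀(S)` -/

/-- **(T1′) THE TRACE OF THE STABILISER ON `C₀(S)` IS THE SUM OF THE LEVEL TRACES OVER THE FIXED VERTICES**: for `g ∈ P` (the stabiliser of the finite `S`, `hP`), `ρ₀` the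
representation of `P` on `C₀(S) = ⊕_{x ∈ S} V^{U_x}·[x]` of ★ 41d FILE II (`hρ₀`, `hτ`), transported compact open vertex groups (`hUa`, `hUo`, `hUc`) and finite-dimensional blocks (`hfd`):
`tr(ρ₀ g | C₀(S)) = Σ_{x ∈ S, a g x = x} Θ_{U_x}(g)`. [cite: MeyerSolleveld2010, §1 p. 4; §4 Prop. 4.1] [cite: SchneiderStuhler1997, Ch. III §4] [cite: Korman2004, §4] -/
theorem trace_rep_zeroChains_eq_sum {U : ι → Subgroup Γ} {S : Set ι} (hS : S.Finite) (hfd : ∀ x ∈ S, FiniteDimensional k (ρ.fixedPoints (U x)))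
    (hUo : ∀ x, IsOpen (U x : Set Γ)) (hUc : ∀ x, IsCompact (U x : Set Γ))
    (hUa : ∀ (g : Γ) (x : ι), U (a g x) = (U x).map (MulAut.conj g).toMonoidHom)
    {P : Subgroup Γ} (hP : ∀ g ∈ P, ∀ x, a g x ∈ S ↔ x ∈ S)
    {τ : Representation k Γ (ι →₀ V)} (hτ : ∀ (g : Γ) (v : ι →₀ V), τ g v = Finsupp.mapRange (ρ g) (map_zero _) (Finsupp.equivMapDomain (a g).toEquiv v))
    {ρ₀ : Representation k P ↥(⨆ x ∈ S, (ρ.fixedPoints (U x)).map (Finsupp.lsingle x : V →ₗ[k] ι →₀ V))}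
    (hρ₀ : ∀ (g : P) (v : ↥(⨆ x ∈ S, (ρ.fixedPoints (U x)).map (Finsupp.lsingle x : V →ₗ[k] ι →₀ V))), ((ρ₀ g v : _) : ι →₀ V) = τ (g : Γ) v)
    (g : P) :
    LinearMap.trace k ↥(⨆ x ∈ S, (ρ.fixedPoints (U x)).map (Finsupp.lsingle x : V →ₗ[k] ι →₀ V)) (ρ₀ g) =
      ∑ x ∈ hS.toFinset with a (g : Γ) x = x, ρ.levelTrace (hUo x) (hUc x) (g : Γ) := by
  classical
  have hφ : ∀ x ∈ hS.toFinset, ∀ v ∈ ρ.fixedPoints (U x), ρ (g : Γ) v ∈ ρ.fixedPoints (U (a (g : Γ) x)) := by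
    intro x _ v hv
    have h := (ρ.mem_fixedPoints_map_conj_iff (U x) (g : Γ) v).2 hv
    rw [← hUa] at h
    exact h
  refine LinearMap.trace_eq_sum_of_finsupp_blocks (B := fun x => ρ.fixedPoints (U x)) (s := hS.toFinset) (fun x hx => hfd x (hS.mem_toFinset.1 hx)) ?_
    (π := fun x => a (g : Γ) x) ?_ (a (g : Γ)).injective.injOn (φ := ρ (g : Γ)) hφ (fun x _ hx v hv => mapsTo_fixedPoints_of_apply_eq hUa hx hv) (F := τ (g : Γ)) ?_
    (fun w => hρ₀ g w) ?_
  · simp only [Set.Finite.mem_toFinset]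
  · intro x hx
    rw [Set.Finite.mem_toFinset] at hx ⊢
    exact (hP g g.2 x).2 hx
  · intro x _ v _
    rw [hτ, Finsupp.equivMapDomain_single, Finsupp.mapRange_single]
    rfl
  · intro x _ hπx
    exact ρ.levelTrace_eq_trace_restrict_of_mem_normalizer (hUo x) (hUc x) (mem_normalizer_of_apply_eq hUa hπx)

/-! ## §3 (T2′) The trace on the `1`-chains `C₁(S)` -/

/-- **(T2′) THE TRACE OF THE STABILISER ON `C₁(S)` IS THE SUM OF THE LEVEL TRACES OVER THE FIXED EDGES** (invariant orientation `hσa`, edge groups `U_e = U_{head e} ⊔ U_{tail e}`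
compact open, `ρ₁` of ★ 41d FILE II): `tr(ρ₁ g | C₁(S)) = Σ_{e ⊆ S, (a g)·e = e} Θ_{U_e}(g)`. [cite: MeyerSolleveld2010, §1 p. 4; §4 Prop. 4.1] [cite: SchneiderStuhler1997, Ch. III §4]
[cite: Korman2004, §4] -/
theorem trace_rep_oneChains_eq_sum {σ : Orientation G} {U : ι → Subgroup Γ} {S : Set ι} (hS : S.Finite)
    (hfd₁ : ∀ e : G.edgeSet, σ.head e ∈ S → σ.tail e ∈ S → FiniteDimensional k (ρ.fixedPoints (U (σ.head e) ⊔ U (σ.tail e))))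
    (hEo : ∀ e : G.edgeSet, IsOpen ((U (σ.head e) ⊔ U (σ.tail e) : Subgroup Γ) : Set Γ)) (hEc : ∀ e : G.edgeSet, IsCompact ((U (σ.head e) ⊔ U (σ.tail e) : Subgroup Γ) : Set Γ))
    (hUa : ∀ (g : Γ) (x : ι), U (a g x) = (U x).map (MulAut.conj g).toMonoidHom)
    (hσa : ∀ (g : Γ) (e : G.edgeSet), σ.head ((a g).mapEdgeSet e) = a g (σ.head e) ∧ σ.tail ((a g).mapEdgeSet e) = a g (σ.tail e))
    {P : Subgroup Γ} (hP : ∀ g ∈ P, ∀ x, a g x ∈ S ↔ x ∈ S)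
    {τ₁ : Representation k Γ (G.edgeSet →₀ V)}
    (hτ₁ : ∀ (g : Γ) (c : G.edgeSet →₀ V), τ₁ g c = Finsupp.mapRange (ρ g) (map_zero _) (Finsupp.equivMapDomain (a g).mapEdgeSet c))
    {ρ₁ : Representation k P ↥(⨆ e ∈ {e : G.edgeSet | σ.head e ∈ S ∧ σ.tail e ∈ S}, (ρ.fixedPoints (U (σ.head e) ⊔ U (σ.tail e))).map (Finsupp.lsingle e : V →ₗ[k] G.edgeSet →₀ V))}
    (hρ₁ : ∀ (g : P) (c : ↥(⨆ e ∈ {e : G.edgeSet | σ.head e ∈ S ∧ σ.tail e ∈ S}, (ρ.fixedPoints (U (σ.head e) ⊔ U (σ.tail e))).map (Finsupp.lsingle e : V →ₗ[k] G.edgeSet →₀ V))),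
      ((ρ₁ g c : _) : G.edgeSet →₀ V) = τ₁ (g : Γ) c)
    (g : P) :
    LinearMap.trace k ↥(⨆ e ∈ {e : G.edgeSet | σ.head e ∈ S ∧ σ.tail e ∈ S}, (ρ.fixedPoints (U (σ.head e) ⊔ U (σ.tail e))).map (Finsupp.lsingle e : V →ₗ[k] G.edgeSet →₀ V)) (ρ₁ g) =
      ∑ e ∈ (finite_edges_of_finite σ hS).toFinset with (a (g : Γ)).mapEdgeSet e = e, ρ.levelTrace (hEo e) (hEc e) (g : Γ) := by
  classical
  have hφ : ∀ e ∈ (finite_edges_of_finite σ hS).toFinset, ∀ v ∈ ρ.fixedPoints (U (σ.head e) ⊔ U (σ.tail e)),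
      ρ (g : Γ) v ∈ ρ.fixedPoints (U (σ.head ((a (g : Γ)).mapEdgeSet e)) ⊔ U (σ.tail ((a (g : Γ)).mapEdgeSet e))) :=
    fun e _ v hv => apply_mem_fixedPoints_sup_of_mapEdgeSet hUa hσa (g : Γ) e hv
  have hfix : ∀ e ∈ (finite_edges_of_finite σ hS).toFinset, (a (g : Γ)).mapEdgeSet e = e →
      ∀ v ∈ ρ.fixedPoints (U (σ.head e) ⊔ U (σ.tail e)), ρ (g : Γ) v ∈ ρ.fixedPoints (U (σ.head e) ⊔ U (σ.tail e)) := by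
    intro e he hfe v hv
    have h := hφ e he v hv
    rw [hfe] at h
    exact h
  refine LinearMap.trace_eq_sum_of_finsupp_blocks (B := fun e : G.edgeSet => ρ.fixedPoints (U (σ.head e) ⊔ U (σ.tail e))) (s := (finite_edges_of_finite σ hS).toFinset)
    (fun e he => ?_) ?_ (π := fun e => (a (g : Γ)).mapEdgeSet e) ?_ (a (g : Γ)).mapEdgeSet.injective.injOn (φ := ρ (g : Γ)) hφ hfix (F := τ₁ (g : Γ)) ?_
    (fun c => hρ₁ g c) ?_
  · rw [Set.Finite.mem_toFinset] at he
    exact hfd₁ e he.1 he.2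
  · simp only [Set.Finite.mem_toFinset, Set.mem_setOf_eq]
  · intro e he
    rw [Set.Finite.mem_toFinset, Set.mem_setOf_eq] at he ⊢
    rw [(hσa (g : Γ) e).1, (hσa (g : Γ) e).2]
    exact ⟨(hP g g.2 _).2 he.1, (hP g g.2 _).2 he.2⟩
  · intro e _ v _
    rw [hτ₁, Finsupp.equivMapDomain_single, Finsupp.mapRange_single]
  · intro e _ hπe
    exact ρ.levelTrace_eq_trace_restrict_of_mem_normalizer (hEo e) (hEc e) (mem_normalizer_sup_of_mapEdgeSet_eq hUa hσa hπe)

end Representation
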